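import Literature.AlgebraicGeometry.Resolution.CanonicalResolutionProofs
import Mathlib.AlgebraicGeometry.IdealSheaf.Subscheme
import Mathlib.AlgebraicGeometry.Morphisms.ClosedImmersion
import Mathlib.AlgebraicGeometry.Morphisms.Finite
import Mathlib.AlgebraicGeometry.Morphisms.FiniteType

/-!
# `WeightedInvariant.WeightedConstruction`, line `support-first-weights-second`:
# the singular locus of a closed subscheme, seen in the ambient scheme, is closed

Route `ResolutionOfSingularities/WeightedInvariant`, crux `WeightedConstruction`
(stmt-ResolutionOfSingularities-0571), stub `stub_isClosed_singularLocus` of the lead skeleton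
(axiom `(usc)` of the weighted resolution datum at the bottom level needs that the set of points of
`Y` at which the closed subscheme `X` is singular is closed).

For a scheme `Y` locally of finite type over a field `k` and an ideal sheaf `X` on `Y`, the set
`{y ∈ Y | ∃ x ∈ X.subscheme over y, 𝒪_{X.subscheme, x} not regular}` is the image under the closed
immersion `X.subschemeι : X.subscheme ⟶ Y` of the singular locus `(Reg X.subscheme)ᶜ`. The closed
subscheme is again locally of finite type over `k` (a closed immersion is finite), so its regular
locus is open by Matsumura's Corollary to Thm. 30.5, globalised
(`isOpen_regularLocus_of_locallyOfFiniteType_field`, `CanonicalResolutionProofs.lean`: the regular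
locus of a scheme locally of finite type over ANY field is open). A closed immersion is a closed map
on the underlying spaces, whence the claim.

* `image_subschemeι_compl_regularLocus` — the set in the stub is
  `X.subschemeι '' (Reg X.subscheme)ᶜ`.
* `stub_isClosed_singularLocus` — the registered stub.
-/

noncomputable section

set_option linter.dupNamespace false -- mandated namespace of this single-conjunct summit

open CategoryTheory CategoryTheory.Limits AlgebraicGeometry TopologicalSpace
open Literature.AlgebraicGeometry.Resolution

namespace Summit.ResolutionOfSingularities.ResolutionOfSingularities.Theorems

universe u

/-- The set of points of `Y` under which the closed subscheme `X.subscheme` has a non-regular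
stalk is the image under `X.subschemeι` of the singular locus `(Reg X.subscheme)ᶜ`. [folklore] -/
theorem image_subschemeι_compl_regularLocus {Y : Scheme.{u}} (X : Y.IdealSheafData) :
    {y : Y | ∃ x : X.subscheme, X.subschemeι x = y ∧
      ¬ IsRegularLocalRing (X.subscheme.presheaf.stalk x)} =
      X.subschemeι '' (Scheme.regularLocus X.subscheme)ᶜ := by
  ext y
  simp only [Set.mem_setOf_eq, Set.mem_image, Set.mem_compl_iff, Scheme.mem_regularLocus]
  constructor
  · rintro ⟨x, hx, hreg⟩
    exact ⟨x, hreg, hx⟩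
  · rintro ⟨x, hreg, hx⟩
    exact ⟨x, hx, hreg⟩

/-- `stub_isClosed_singularLocus`: for a scheme `Y` locally of finite type over a field and an ideal
sheaf `X` on `Y`, the set of points of `Y` at which `X.subscheme` is singular is closed — it is the
image under the closed immersion `X.subschemeι` (a closed map) of the complement of the regular
locus of `X.subscheme`, which is open because `X.subscheme ⟶ Y ⟶ Spec k` is locally of finite type
over a field (`isOpen_regularLocus_of_locallyOfFiniteType_field`). [folklore] -/
theorem stub_isClosed_singularLocus : ∀ ⦃k : Type⦄ [Field k] ⦃Y : Scheme.{0}⦄ (f : Y ⟶ Spec (.of k))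
    [LocallyOfFiniteType f] (X : Y.IdealSheafData),
    IsClosed {y : Y | ∃ x : X.subscheme, X.subschemeι x = y ∧
      ¬ IsRegularLocalRing (X.subscheme.presheaf.stalk x)} := by
  intro k _ Y f _ X
  have hopen : IsOpen (Scheme.regularLocus X.subscheme) :=
    isOpen_regularLocus_of_locallyOfFiniteType_field (X.subschemeι ≫ f)
  rw [image_subschemeι_compl_regularLocus X]
  exact X.subschemeι.isClosedEmbedding.isClosedMap _ hopen.isClosed_compl

end Summit.ResolutionOfSingularities.ResolutionOfSingularities.Theorems

end
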